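import Literature.AlgebraicGeometry.AbelianVarieties.AbelianVarietyWeilDivisorBundleDictionary
import Literature.AlgebraicGeometry.AbelianVarieties.PoincareSheafOfPrincipal
import Literature.AlgebraicGeometry.Motives.AbelianVarietyWeilPairingAlongIsogeny
import HarnessLib

/-!
# The Kummer bridge: an isotropic kernel kills the `Λ(𝒪(Θ))`-slice under `π^*`
# (`π^*(t_σ^*𝒪(Θ) ⊗ 𝒪(Θ)⁻¹) ≅ 𝒪_B` for `ψ ≫ π = [n]`, `σ ∈ ker ψ ⊆ A[n]` isotropic for `ē^Θ_n`)

Layer `Literature/AlgebraicGeometry/AbelianVarieties`, namespace `Literature.AlgebraicGeometry.AbelianVarieties`.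
THEOREMS ONLY (no definition, no named fact, no instance, no `sorry`).

Let `Ω` be an algebraically closed field, `ψ : A → B` and `π : B → A` homomorphisms of abelian varieties over `Ω`
with `ψ ≫ π = [n]_A` (`n` invertible in `Ω`, `π` dominant, `ψ` onto on `Ω`-points — the two isogenies of a
free quotient `B = A/K` by a finite subgroup `K ⊆ A[n](Ω)`), `Θ` a Cartier divisor on `A` and `σ ∈ A[n](Ω)`.
[MumfordAV1970] §23 (Thm. 2, p. 231): the class `Λ(𝒪(Θ))(σ) = [t_σ^*𝒪(Θ) ⊗ 𝒪(Θ)⁻¹] ∈ Pic⁰(A)` dies under `π^*`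
as soon as the kernel `K ⊇ ker ψ(Ω)` is ISOTROPIC against `σ` for the level-`n` Weil pairing of `Θ`,
`ē^Θ_n(κ, σ) = 1` for all `κ ∈ K ∩ A[n]` (Lang VII §2 / Milne §16 `ē^Θ_n`, the tree's `AbelianVariety.weilPairingLevel`).
The printed argument («`K ⊆ K^⊥ = ker π̂`», [MumfordAV1970] §15 Thm. 1 and §23) is run here in the KUMMER currency of
`Motives/AbelianVarietyWeilPairingLevel`, with no scheme-theoretic dual and no symmetric witness:

* §1 `map_comp_eq_pow` / `pow_map_mem_of_ker_subset` / `exists_torsionPoints_map_eq` — `π(ψ a) = aⁿ`; for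
  `P ∈ B[n·n](Ω)` the point `(π P)ⁿ` lies in `K` (`P = ψ a`, `(π P)ⁿ = a^{n·n}` and `ψ(a^{n·n}) = P^{n·n} = 1`); every
  `σ ∈ A[n](Ω)` has a root `σ′ := ψ σ̃ ∈ B[n·n](Ω)`, `σ̃ⁿ = σ`, `π σ′ = σ` (divisibility of `A(Ω)`);
* §2 **`weilPairingLevel_pullback_root_eq_one`** — for a root `σ′ ∈ B[n·n](Ω)` of `σ` under `π` (`π σ′ = σ`) and every
  `P ∈ B[n·n](Ω)`: `ē^{π^*Θ}_{n·n}(P, σ′) = ē^Θ_{n·n}(π P, σ) = ē^Θ_n((π P)ⁿ, σ) = 1`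
  ([MumfordAV1970] §20 (3) `e(f x, y) = e(x, f̂ y)` as ★ `weilPairingLevel_pullback_eq`; Lang VII §2 Prop. 5 as ★
  `weilPairingLevel_level_mul`; then the isotropy);
* §3 **`weilDiv_pullback_linEquiv_zero_of_forall_weilPairingLevel_eq_one`** — Lang VII §2 Prop. 4 on `B` (★
  `weilDiv_linEquiv_zero_of_forall_weilPairingLevel_eq_one`; Kummer hypotheses of `[n·n]_B` over `Ω = Ω̄` as in ★
  `AbelianVarietyWeilPairingRadicalComposite`) gives `D_{σ′}(π^*Θ) ∼ 0`, i.e. `π^*D_σ(Θ) ∼ 0`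
  (★ `weilDiv_pullback_sameDivisor`), the root `σ′ := ψ σ̃`, `σ̃ⁿ = σ` coming from the divisibility of `A(Ω)`;
* §4 **`nonempty_pullback_translateTensorDual_iso_unit_of_forall_weilPairingLevel_eq_one`** — THE HEAD, in the module
  currency of [MumfordFogartyKirwan1994] Def. 6.2 / the tree's ★ `IsLambdaOfAt`: `π^*(t_σ^*𝒪(Θ) ⊗ 𝒪(Θ)⁻¹) ≅ 𝒪_B`
  ((D-2) dictionary ★ `nonempty_pullback_translateTensorDual_iso`, ★ `detClass_translateTensorDual_eq_cechClass_weilDiv`,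
  ★ `nonempty_iso_unitModule_of_detClass_eq_one`).

Cell `hodgecm-mathlib` (D-0151), HECKE-LINK D6 `h4`/`Φ` package, brick (H-iso-2) «the Kummer bridge» (B-p04 (g18)
2026-08-30T00:55:40Z road; B-p21 (g15)); consumers: (H-iso-3) (the `hiso` binder of `map_le_poincareStabilizerSubgroup`,
B-p18 (g17)) and (H-iso-1) (isotropy of the Hecke kernel from the symplectic level structure, B-p04 (g18)).
Count-neutral; HC_CM is proved only modulo the 7 printed citations until rung 0 closes — nothing here is about HC.

## References
* [MumfordAV1970] D. Mumford, *Abelian Varieties* (1970), §15 Thm. 1 (p. 143), §20 (pp. 183–186, property (3) of `e_n`),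
  §23 Thm. 2 (p. 231).
* [Lang1983AbelianVarieties] S. Lang, *Abelian Varieties*, Ch. VII §2, Props. 3–5 (PDF pp. 138–140).
* [Milne1986AbelianVarieties] J. S. Milne, *Abelian varieties*, in Cornell–Silverman (1986), §16 p. 132 and Lemma 16.1.
* [MumfordFogartyKirwan1994] D. Mumford, J. Fogarty, F. Kirwan, *Geometric Invariant Theory*, 3rd ed. (1994), Ch. 6 §2
  Definition 6.2 (p. 120).
* [Hartshorne1977] R. Hartshorne, *Algebraic Geometry* (1977), III Ex. 4.5.
-/

noncomputable section

universe u

open CategoryTheory CategoryTheory.Limits AlgebraicGeometry MonoidalCategory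

namespace Literature.AlgebraicGeometry.AbelianVarieties

open Literature.AlgebraicGeometry.Motives Literature.AlgebraicGeometry.Motives.AbelianVariety
  Literature.AlgebraicGeometry.Modules
open scoped MonObj

variable {Ω : Type u} [Field Ω] {A B : AbelianVariety Ω} (ψ : A ⟶ B) (π : B ⟶ A) {n : ℕ}

/-! ## §1 Points: `π(ψ a) = aⁿ`, and `(π P)ⁿ ∈ K` for `P ∈ B[n·n]` -/

/-- `π(ψ a) = aⁿ` on `Ω`-points when `ψ ≫ π = [n]_A`. [cite: MumfordAV1970, §7 Thm. 4 (p. 72)] -/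
theorem map_comp_eq_pow (hψπ : ψ ≫ π = (n : ℤ) • 𝟙 A) (a : A.Points Ω) :
    AlgPoints.map π.hom.hom.hom (AlgPoints.map ψ.hom.hom.hom a) = a ^ n := by
  rw [← AlgPoints.map_comp_apply, ← zpow_natCast, zpow_eq_comp_zsmul_id a (n : ℤ), ← hψπ]
  rfl

/-- **`(π P)ⁿ ∈ K` for `P ∈ B[n·n](Ω)`**: if `ψ` is onto on `Ω`-points and `K` contains the `Ω`-points killed by `ψ`,
then for every `P ∈ B[n·n](Ω)` the `n`-torsion point `(π P)ⁿ` lies in `K` (`P = ψ a`, `(π P)ⁿ = a^{n·n}`,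
`ψ(a^{n·n}) = P^{n·n} = 1`). [cite: MumfordAV1970, §7 Thm. 4 (p. 72)] -/
theorem pow_map_mem_of_ker_subset (hψπ : ψ ≫ π = (n : ℤ) • 𝟙 A)
    (hsurj : ∀ b : B.Points Ω, ∃ a : A.Points Ω, AlgPoints.map ψ.hom.hom.hom a = b)
    (Kset : Set (A.Points Ω)) (hker : ∀ a : A.Points Ω, AlgPoints.map ψ.hom.hom.hom a = 1 → a ∈ Kset)
    (P : B.torsionPoints Ω ((n * n : ℕ) : ℤ)) :
    (AlgPoints.map π.hom.hom.hom (P : B.Points Ω)) ^ n ∈ Kset := by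
  obtain ⟨a, ha⟩ := hsurj P
  have h1 : (AlgPoints.map π.hom.hom.hom (P : B.Points Ω)) ^ n = a ^ (n * n) := by
    rw [← ha, map_comp_eq_pow ψ π hψπ, ← pow_mul]
  rw [h1]
  apply hker
  rw [map_pow_eq, ha]
  exact coe_torsionPoints_pow_eq_one P

/-- **A root of `σ` under `π` in `B[n·n]`**: if `A(Ω)` is `n`-divisible (★ `pow_surjective_of_cast_ne_zero`) then every
`σ ∈ A[n](Ω)` is `π σ′` for some `σ′ ∈ B[n·n](Ω)` — namely `σ′ := ψ σ̃` with `σ̃ⁿ = σ`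
(`(ψ σ̃)^{n·n} = ψ(σⁿ) = 1`, `π(ψ σ̃) = σ̃ⁿ = σ`). [cite: MumfordAV1970, §6 Application 2 (p. 62) and §7 Thm. 4 (p. 72)] -/
theorem exists_torsionPoints_map_eq (hψπ : ψ ≫ π = (n : ℤ) • 𝟙 A)
    (hdiv : Function.Surjective fun P : A.Points Ω => P ^ n) (σ : A.torsionPoints Ω n) :
    ∃ σ' : B.torsionPoints Ω ((n * n : ℕ) : ℤ), AlgPoints.map π.hom.hom.hom (σ' : B.Points Ω) = σ := by
  obtain ⟨σt, hσt⟩ := hdiv σ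
  have h1 : AlgPoints.map ψ.hom.hom.hom (1 : A.Points Ω) = 1 := by
    unfold AlgPoints.map
    exact MonObj.one_comp _
  have hσ'mem : AlgPoints.map ψ.hom.hom.hom σt ∈ B.torsionPoints Ω ((n * n : ℕ) : ℤ) := by
    rw [mem_torsionPoints_iff, zpow_natCast, ← map_pow_eq, pow_mul, show σt ^ n = σ from hσt,
      coe_torsionPoints_pow_eq_one σ, h1]
  refine ⟨⟨_, hσ'mem⟩, ?_⟩
  change AlgPoints.map π.hom.hom.hom (AlgPoints.map ψ.hom.hom.hom σt) = σ
  rw [map_comp_eq_pow ψ π hψπ]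
  exact hσt

/-! ## §2 The pairing on `B`: `ē^{π^*Θ}_{n·n}(P, σ′) = 1` -/

section Pairing

variable [IsDominant (Hom.toSchemeHom π)]
  [IsDominant (Hom.toSchemeHom ((n : ℤ) • 𝟙 A))]
  [IsDominant (Hom.toSchemeHom (((n * n : ℕ) : ℤ) • 𝟙 A))]
  [IsDominant (Hom.toSchemeHom (((n * n : ℕ) : ℤ) • 𝟙 B))]

/-- **`ē^{π^*Θ}_{n·n}(P, σ′) = 1`**: for `ψ ≫ π = [n]`, `ψ` onto on `Ω`-points with `Ω`-kernel inside `K`, an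
`n`-torsion point `σ` ISOTROPIC against `K` (`ē^Θ_n(κ, σ) = 1` for `κ ∈ K ∩ A[n]`), a root `σ′ ∈ B[n·n]` of `σ` under
`π`, and any `P ∈ B[n·n]`: `ē^{π^*Θ}_{n·n}(P, σ′) = ē^Θ_{n·n}(π P, σ)` ([MumfordAV1970] §20 (3)) `= ē^Θ_n((π P)ⁿ, σ)`
(Lang VII §2 Prop. 5) `= 1` (§1). [cite: MumfordAV1970, §20 (property (3) of e_n, p. 186) and §23 Thm. 2 (p. 231)]
[cite: Lang1983AbelianVarieties, Ch. VII §2 Prop. 5] -/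
theorem weilPairingLevel_pullback_root_eq_one (hψπ : ψ ≫ π = (n : ℤ) • 𝟙 A)
    (hsurj : ∀ b : B.Points Ω, ∃ a : A.Points Ω, AlgPoints.map ψ.hom.hom.hom a = b)
    (Kset : Set (A.Points Ω)) (hker : ∀ a : A.Points Ω, AlgPoints.map ψ.hom.hom.hom a = 1 → a ∈ Kset)
    (Θ : CartierDivisor A.X.left) (σ : A.torsionPoints Ω n)
    (hiso : ∀ κ : A.torsionPoints Ω n, (κ : A.Points Ω) ∈ Kset → A.weilPairingLevel Θ κ σ = 1)
    (σ' : B.torsionPoints Ω ((n * n : ℕ) : ℤ)) (hσ' : AlgPoints.map π.hom.hom.hom (σ' : B.Points Ω) = σ)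
    (P : B.torsionPoints Ω ((n * n : ℕ) : ℤ)) :
    B.weilPairingLevel (N := n * n) (Θ.pullback (Hom.toSchemeHom π)) P σ' = 1 := by
  -- `ē^{π^*Θ}(P, σ′) = ē^Θ(π P, σ)` with `σ` read in `A[n·n]`
  rw [weilPairingLevel_pullback_eq π (Θ := Θ) P σ'
    ⟨AlgPoints.map π.hom.hom.hom P.1, map_mem_torsionPoints π P.2⟩ (A.torsionPointsOfDvd n σ) rfl
    (by rw [coe_torsionPointsOfDvd, hσ']),
    -- Lang VII §2 Prop. 5: `ē_{n·n}(a, σ) = ē_n(aⁿ, σ)`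
    weilPairingLevel_level_mul]
  exact hiso _ (pow_map_mem_of_ker_subset ψ π hψπ hsurj Kset hker P)

end Pairing

/-! ## §3 Lang VII §2 Prop. 4 on `B`: `π^* D_σ(Θ) ∼ 0` -/

section AlgClosed

variable [IsAlgClosed Ω] [IsDominant (Hom.toSchemeHom π)]

omit [IsAlgClosed Ω] [IsDominant (Hom.toSchemeHom π)] in
/-- `[N]` is dominant when `N` is invertible in `Ω` (an isogeny, ★ `isIsogeny_zsmul_id_of_cast_ne_zero`).
[cite: MumfordAV1970, §6 Application 2 (p. 62)] -/
theorem isDominant_toSchemeHom_natCast_smul (C : AbelianVariety Ω) {N : ℕ} (hN : (N : Ω) ≠ 0) :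
    IsDominant (Hom.toSchemeHom ((N : ℤ) • 𝟙 C)) :=
  ⟨(C.isIsogeny_zsmul_id_of_cast_ne_zero (N : ℤ) (by exact_mod_cast hN)).1.1.denseRange⟩

/-- **`D_{σ′}(π^*Θ) ∼ 0` on `B`** for a root `σ′ ∈ B[n·n](Ω)` of the isotropic `σ` under `π` — Lang VII §2 Prop. 4
(«if `e_n(a, ξ) = 1` for all `a ∈ g_n` then `ξ = 0`») applied on `B` at level `n·n` to `ξ = Cl(D_{σ′}(π^*Θ))`, all pairings
being `1` by §2; the Kummer hypotheses on `[n·n]_B` (isogeny, flat, degree `#B[n·n](Ω)`) hold over `Ω = Ω̄` with `n`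
invertible. [cite: Lang1983AbelianVarieties, Ch. VII §2 Prop. 4] [cite: MumfordAV1970, §23 Thm. 2 (p. 231)] -/
theorem weilDiv_root_linEquiv_zero_of_forall_weilPairingLevel_eq_one (hn : (n : Ω) ≠ 0)
    (hψπ : ψ ≫ π = (n : ℤ) • 𝟙 A)
    (hsurj : ∀ b : B.Points Ω, ∃ a : A.Points Ω, AlgPoints.map ψ.hom.hom.hom a = b)
    (Kset : Set (A.Points Ω)) (hker : ∀ a : A.Points Ω, AlgPoints.map ψ.hom.hom.hom a = 1 → a ∈ Kset)
    (Θ : CartierDivisor A.X.left) (σ : A.torsionPoints Ω n)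
    (hiso : ∀ [IsDominant (Hom.toSchemeHom ((n : ℤ) • 𝟙 A))] (κ : A.torsionPoints Ω n),
      (κ : A.Points Ω) ∈ Kset → A.weilPairingLevel Θ κ σ = 1)
    (σ' : B.torsionPoints Ω ((n * n : ℕ) : ℤ)) (hσ' : AlgPoints.map π.hom.hom.hom (σ' : B.Points Ω) = σ) :
    (B.weilDiv (Θ.pullback (Hom.toSchemeHom π)) (σ' : B.Points Ω)).LinEquiv 0 := by
  have hn0 : n ≠ 0 := by rintro rfl; exact hn (by simp)
  have hN0 : n * n ≠ 0 := Nat.mul_ne_zero hn0 hn0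
  have hNΩ : ((n * n : ℕ) : Ω) ≠ 0 := by rw [Nat.cast_mul]; exact mul_ne_zero hn hn
  have hNZ : ((n * n : ℕ) : ℤ) ≠ 0 := Int.natCast_ne_zero.mpr hN0
  have hNL : (((n * n : ℕ) : ℤ) : Ω) ≠ 0 := by rwa [Int.cast_natCast]
  haveI := isDominant_toSchemeHom_natCast_smul A hn
  haveI := isDominant_toSchemeHom_natCast_smul A hNΩ
  haveI := isDominant_toSchemeHom_natCast_smul B hNΩ
  -- the Kummer-theory hypotheses on `[n·n]_B`
  have hisoB : IsIsogeny (((n * n : ℕ) : ℤ) • 𝟙 B) := isIsogeny_zsmul_id_holds B _ hNZ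
  haveI : Surjective (Hom.toSchemeHom (((n * n : ℕ) : ℤ) • 𝟙 B)) := hisoB.1
  haveI : IsFinite (Hom.toSchemeHom (((n * n : ℕ) : ℤ) • 𝟙 B)) := hisoB.2
  haveI : Flat (Hom.toSchemeHom (((n * n : ℕ) : ℤ) • 𝟙 B)) := IsIsogeny.flat_toSchemeHom_holds hisoB
  have hcard : Nat.card (B.torsionPoints Ω ((n * n : ℕ) : ℤ)) = (((n * n : ℕ)) : ℤ).natAbs ^ (2 * B.dim) :=
    natCard_torsionPoints_eq_of_isAlgClosed B Ω _ hNL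
  haveI : Finite (B.torsionPoints Ω ((n * n : ℕ) : ℤ)) :=
    Nat.finite_of_card_ne_zero (by
      rw [hcard, Int.natAbs_natCast]
      exact pow_ne_zero _ hN0)
  have hdeg : Module.finrank B.X.left.functionField
      (FunctionFieldOver (Hom.toSchemeHom (((n * n : ℕ) : ℤ) • 𝟙 B))) =
        Nat.card (B.torsionPoints Ω ((n * n : ℕ) : ℤ)) := by
    rw [← hisoB.kerRank_eq_finrank_functionFieldOver, kerRank_zsmul_id_holds B _ hNZ, hcard]
  -- Lang VII §2 Prop. 4 on `B`
  exact weilDiv_linEquiv_zero_of_forall_weilPairingLevel_eq_one (Nat.pos_of_ne_zero hN0) hdeg _ σ'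
    (weilPairingLevel_pullback_root_eq_one ψ π hψπ hsurj Kset hker Θ σ (fun κ hκ => hiso κ hκ) σ' hσ')

/-- **`π^* D_σ(Θ) ∼ 0` on `B`** (divisor form of the head): with `A(Ω)` `n`-divisible (`hdiv`, ★
`pow_surjective_of_cast_ne_zero`), pick `σ̃` with `σ̃ⁿ = σ`; the root `σ′ := ψ σ̃ ∈ B[n·n](Ω)` has `π σ′ = σ`, so
`π^*D_σ(Θ) = D_{σ′}(π^*Θ) ∼ 0` (★ `weilDiv_pullback_sameDivisor` and §3). [cite: MumfordAV1970, §23 Thm. 2 (p. 231)]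
[cite: Lang1983AbelianVarieties, Ch. VII §2 Prop. 4] -/
theorem weilDiv_pullback_linEquiv_zero_of_forall_weilPairingLevel_eq_one (hn : (n : Ω) ≠ 0)
    (hψπ : ψ ≫ π = (n : ℤ) • 𝟙 A) (hdiv : Function.Surjective fun P : A.Points Ω => P ^ n)
    (hsurj : ∀ b : B.Points Ω, ∃ a : A.Points Ω, AlgPoints.map ψ.hom.hom.hom a = b)
    (Kset : Set (A.Points Ω)) (hker : ∀ a : A.Points Ω, AlgPoints.map ψ.hom.hom.hom a = 1 → a ∈ Kset)
    (Θ : CartierDivisor A.X.left) (σ : A.torsionPoints Ω n)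
    (hiso : ∀ [IsDominant (Hom.toSchemeHom ((n : ℤ) • 𝟙 A))] (κ : A.torsionPoints Ω n),
      (κ : A.Points Ω) ∈ Kset → A.weilPairingLevel Θ κ σ = 1) :
    ((A.weilDiv Θ (σ : A.Points Ω)).pullback (Hom.toSchemeHom π)).LinEquiv 0 := by
  -- the root `σ′ := ψ σ̃`, `σ̃ⁿ = σ`
  obtain ⟨σ', hσ'⟩ := exists_torsionPoints_map_eq ψ π hψπ hdiv σ
  have h := weilDiv_root_linEquiv_zero_of_forall_weilPairingLevel_eq_one ψ π hn hψπ hsurj Kset hker Θ σ hiso σ' hσ'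
  -- `π^*D_σ(Θ) = D_{σ′}(π^*Θ)`
  have hsame := weilDiv_pullback_sameDivisor π Θ (σ' : B.Points Ω)
  rw [hσ'] at hsame
  exact hsame.linEquiv.symm.trans h

/-! ## §4 The head: `π^*(t_σ^*𝒪(Θ) ⊗ 𝒪(Θ)⁻¹) ≅ 𝒪_B` -/

/-- **THE KUMMER BRIDGE** — `π^*(t_σ^*𝒪(Θ) ⊗ 𝒪(Θ)⁻¹) ≅ 𝒪_B`: for homomorphisms `ψ : A → B`, `π : B → A` of abelian
varieties over an algebraically closed field `Ω` with `ψ ≫ π = [n]_A` (`n` invertible in `Ω`, `π` dominant, `ψ` onto on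
`Ω`-points, `A(Ω)` `n`-divisible), a set `K ⊆ A(Ω)` containing the `Ω`-kernel of `ψ`, a Cartier divisor `Θ` on `A` and an
`n`-torsion point `σ` ISOTROPIC against `K` for `ē^Θ_n` (`ē^Θ_n(κ, σ) = 1` for all `κ ∈ K ∩ A[n](Ω)`), the pull-back
along `π` of the `Λ(𝒪(Θ))`-slice `t_σ^*𝒪(Θ) ⊗ 𝒪(Θ)⁻¹` ([MumfordFogartyKirwan1994] Def. 6.2) is the trivial module.
This is [MumfordAV1970] §23 Thm. 2's isotropy condition at work («`λ(σ) ∈ K^⊥ = ker π̂`», §15 Thm. 1), proved in the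
Kummer currency: §3 gives `D_{σ′}(π^*Θ) ∼ 0` for a root `σ′` of `σ`, and the (D-2) dictionary
(★ `nonempty_pullback_translateTensorDual_iso`, ★ `detClass_translateTensorDual_eq_cechClass_weilDiv`, Hartshorne III
Ex. 4.5) turns it into the module isomorphism. [cite: MumfordAV1970, §23 Thm. 2 (p. 231) and §15 Thm. 1 (p. 143)]
[cite: Lang1983AbelianVarieties, Ch. VII §2 Prop. 4] [cite: MumfordFogartyKirwan1994, Ch. 6 §2 Definition 6.2 (p. 120)]
[cite: Hartshorne1977, III Ex. 4.5] -/
theorem nonempty_pullback_translateTensorDual_iso_unit_of_forall_weilPairingLevel_eq_one (hn : (n : Ω) ≠ 0)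
    (hψπ : ψ ≫ π = (n : ℤ) • 𝟙 A) (hdiv : Function.Surjective fun P : A.Points Ω => P ^ n)
    (hsurj : ∀ b : B.Points Ω, ∃ a : A.Points Ω, AlgPoints.map ψ.hom.hom.hom a = b)
    (Kset : Set (A.Points Ω)) (hker : ∀ a : A.Points Ω, AlgPoints.map ψ.hom.hom.hom a = 1 → a ∈ Kset)
    (Θ : CartierDivisor A.X.left) (σ : A.torsionPoints Ω n)
    (hiso : ∀ [IsDominant (Hom.toSchemeHom ((n : ℤ) • 𝟙 A))] (κ : A.torsionPoints Ω n),
      (κ : A.Points Ω) ∈ Kset → A.weilPairingLevel Θ κ σ = 1) :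
    Nonempty ((Scheme.Modules.pullback (Hom.toSchemeHom π)).obj
        (tensorObj ((Scheme.Modules.pullback (A.translation (σ : A.Points Ω)).left).obj (lineBundle Θ.toUnitCocycle))
          (Modules.dual (lineBundle Θ.toUnitCocycle))) ≅
      SheafOfModules.unit _) := by
  -- the root `σ′ := ψ σ̃`, `σ̃ⁿ = σ`, with `D_{σ′}(π^*Θ) ∼ 0`
  obtain ⟨σ', hσ'⟩ := exists_torsionPoints_map_eq ψ π hψπ hdiv σ
  have h0 := weilDiv_root_linEquiv_zero_of_forall_weilPairingLevel_eq_one ψ π hn hψπ hsurj Kset hker Θ σ hiso σ' hσ'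
  -- `π^*(t_σ^*𝒪(Θ) ⊗ 𝒪(Θ)⁻¹) ≅ t_{σ′}^*𝒪(π^*Θ) ⊗ 𝒪(π^*Θ)⁻¹`
  obtain ⟨e₁⟩ := nonempty_pullback_translateTensorDual_iso A π Θ (σ' : B.Points Ω)
  rw [hσ'] at e₁
  -- `[t_{σ′}^*𝒪(π^*Θ) ⊗ 𝒪(π^*Θ)⁻¹] = [𝒪(D_{σ′}(π^*Θ))] = [𝒪(0)] = 1`
  set Ξ : CartierDivisor B.X.left := Θ.pullback (Hom.toSchemeHom π) with hΞ
  have hr : HasRank (tensorObj ((Scheme.Modules.pullback (B.translation (σ' : B.Points Ω)).left).obj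
      (lineBundle Ξ.toUnitCocycle)) (Modules.dual (lineBundle Ξ.toUnitCocycle))) 1 :=
    hasRank_tensorObj_one (hasRank_pullback _ Ξ.toUnitCocycle.hasRank_lineBundle)
      (hasRank_dual Ξ.toUnitCocycle.hasRank_lineBundle)
  have hcl : detClass (HasRank.isFiniteLocallyFree' hr) = 1 := by
    rw [detClass_translateTensorDual_eq_cechClass_weilDiv B, (CartierDivisor.cechClass_eq_iff_linEquiv _ _).2 h0,
      CartierDivisor.cechClass_zero]
  obtain ⟨e₂⟩ := nonempty_iso_unitModule_of_detClass_eq_one hr (HasRank.isFiniteLocallyFree' hr) hcl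
  exact ⟨e₁ ≪≫ e₂⟩

end AlgClosed

end Literature.AlgebraicGeometry.AbelianVarieties

end
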